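import Literature.MathematicalPhysics.QuantumFieldTheory.Balaban1983to89.T4CouplingMatching

/-!
# Spine/NE4/ScaleShiftFreeStep — NE4 read at ZERO bare coupling: given that `β_{k+2}` forgets its own bare coupling, NE4 is the
# statement that the β-functions forget ONE EXTRA ULTRAVIOLET STEP TAKEN AT VANISHING COUPLING, geometrically in the number of steps
# below it (cell `pub-balaban-gaps`, seat ne4, generation 19; census item (R62), final form of its β-level half)

HONEST FRAMING.  Bookkeeping for rung (B)+1 on ONE FIXED finite four-torus — NOT ℝ⁴, NOT infinite volume, NOT a mass gap, NOT Clay.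
NE4 = `T4CouplingMatching.ScaleShiftRate` is NOT PRINTED and NOT PROVED here; spine estimates proved 0∕9, unchanged.  Every hypothesis on
`β` is an UNPRINTED input; nothing of Bałaban's is instantiated or asserted.  0 `def`, 0 sorry.

WHAT.  `ScaleShiftBareCorner.scaleShiftRate_of_bareCorner_column` reduces NE4, given ONE column of the history moduli (the influence
`Λ (k+1) 0 ≤ C·ω^{k+1}` of the bare coupling on `β_{k+2}`), to the two-depth bound at SOME arbitrarily small bare coupling.  If `β_{k+2}(·, v)`
has a RIGHT LIMIT at bare coupling `0` — [Balaban1987RG1] p. 264 prints the β-functions as «a smooth function defined on the interval [0, γ]»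
in the LAST variable; for the FIRST variable nothing is printed, so this is a hypothesis — then that corner bound is a statement about the
limit value `β_{k+2}(0⁺, v)`:

* §1 `bareCorner_of_rightLimit` — if for every `k` and tail `v ∈ ]0,γ]^{k+1}` the map `ε ↦ β_{k+2}(ε, v)` tends to some `L` as `ε → 0⁺` with
  `|L − β_{k+1}(v)| ≤ c·θ^k`, then the corner hypothesis of `ScaleShiftBareCorner` §1∕§5 holds;
* §2 `rightLimit_bound_of_scaleShiftRate` — conversely NE4 bounds the limit value: `|β_{k+2}(0⁺, v) − β_{k+1}(v)| ≤ c·θ^k`.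
  COMPOSITION BY NAME (not restated here; the importing module's olean is built by the farm after this file): §1's conclusion is
  VERBATIM the hypothesis `hβ0` of `ScaleShiftBareCorner.shiftEnvelope_of_bareCorner_column` ∕ `scaleShiftRate_of_bareCorner_column`, so
  «right limits at zero bare coupling within `c·θ^k`» + «the bare column `0 ≤ Λ (k+1) 0 ≤ C·ω^{k+1}` of `HistLipschitz Λ γ β`» ⇒
  `ScaleShiftRate (c + C·γ·ω) (max θ ω) γ β`.

READING (heuristic, NOT a tree fact; recorded for the NODE-O card).  For Bałaban's β-functions the first argument `g_0` is the coupling at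
which the FIRST fluctuation integral below the cutoff is performed; `g_0 → 0⁺` makes that step the free (Gaussian) block-averaging step.  So,
modulo the bare column of the memory companion, NE4 reads: «the β-function after k+1 further steps forgets ONE FREE AVERAGING STEP applied
to the initial Wilson action, at the rate θ^k» — an irrelevant-perturbation statement about the INITIAL ACTION within the free universality
class, with no reference to runs, pinning or bare-coupling remnants.  Nothing of this reading is asserted about [Balaban1987RG1]'s objects.
No status word moves: NE4 DEPENDENT (⇐ NE5 ∧ (AF-0r)); NOT IN PRINT; NOT PROVED; 0∕9.  HONEST DEPENDENCY (cell, verbatim): continuum YM on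
T⁴ ⇐ BetaPertH ∧ nine spine estimates (0∕9 proved); BetaPertH ⇐ (D1) ∧ (D4) ∧ CAP+tail.

Reference (TYPE only): [Balaban1987RG1] = T. Bałaban, Commun. Math. Phys. **109** (1987) 249–301, (1.20)–(1.22) and p. 264, §5 p. 298.
-/

noncomputable section

open Filter Topology

namespace Summit.QuantumFields.BalabanUV.T4Continuum.Spine.NE4.ScaleShiftFreeStep

open Literature.MathematicalPhysics.QuantumFieldTheory.Balaban1983to89
open Literature.MathematicalPhysics.QuantumFieldTheory.Balaban1983to89.FlowStep
open T4CouplingMatching (ScaleShiftRate)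

/-! ## §1 A right limit at zero bare coupling gives the corner form -/

/-- **THE CORNER FORM FROM A RIGHT LIMIT AT ZERO BARE COUPLING.**  If for every scale `k` and every tail history `v ∈ ]0,γ]^{k+1}` the
function `ε ↦ β_{k+2}(ε, v)` has a limit `L` as `ε → 0⁺` with `|L − β_{k+1}(v)| ≤ e_k`, then for every `η > 0` some bare coupling `ε ∈ ]0,γ]`
has `|β_{k+2}(ε, v) − β_{k+1}(v)| ≤ e_k + η` (`γ > 0`) — the hypothesis of `ScaleShiftBareCorner.shiftEnvelope_of_bareCorner_column`.  The
right limit in the FIRST variable is an UNPRINTED hypothesis ([Balaban1987RG1] p. 264 prints continuity on `[0, γ]` in the LAST variable only).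
[cite: Balaban1987RG1, §1 p.264] -/
theorem bareCorner_of_rightLimit {β : HBeta} {γ : ℝ} {e : ℕ → ℝ} (hγ : 0 < γ)
    (hlim : ∀ k (v : Fin (k + 1) → ℝ), v ∈ Box γ k →
      ∃ L : ℝ, Tendsto (fun ε : ℝ => β (k + 1) (Fin.cons ε v)) (𝓝[>] 0) (𝓝 L) ∧ |L - β k v| ≤ e k) :
    ∀ k (v : Fin (k + 1) → ℝ), v ∈ Box γ k → ∀ η : ℝ, 0 < η →
      ∃ ε : ℝ, 0 < ε ∧ ε ≤ γ ∧ |β (k + 1) (Fin.cons ε v) - β k v| ≤ e k + η := by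
  intro k v hv η hη
  obtain ⟨L, hL, hLe⟩ := hlim k v hv
  obtain ⟨δ, hδ, hclose⟩ := (Metric.tendsto_nhdsWithin_nhds.mp hL) η hη
  -- take `ε = min (γ, δ∕2) ∈ ]0, γ]`, within `δ` of `0`
  refine ⟨min γ (δ / 2), lt_min hγ (by linarith), min_le_left _ _, ?_⟩
  have hε0 : 0 < min γ (δ / 2) := lt_min hγ (by linarith)
  have hεδ : dist (min γ (δ / 2)) 0 < δ := by
    rw [Real.dist_eq, sub_zero, abs_of_pos hε0]
    exact lt_of_le_of_lt (min_le_right _ _) (by linarith)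
  have h := hclose (Set.mem_Ioi.mpr hε0) hεδ
  rw [Real.dist_eq] at h
  calc |β (k + 1) (Fin.cons (min γ (δ / 2)) v) - β k v|
      = |(β (k + 1) (Fin.cons (min γ (δ / 2)) v) - L) + (L - β k v)| := by ring_nf
    _ ≤ |β (k + 1) (Fin.cons (min γ (δ / 2)) v) - L| + |L - β k v| := abs_add_le _ _
    _ ≤ η + e k := add_le_add h.le hLe
    _ = e k + η := add_comm _ _

/-! ## §2 The converse: NE4 bounds the limit value at zero bare coupling -/

/-- **CONVERSELY**, NE4 and a right limit give the zero-coupling bound: if `ScaleShiftRate c θ γ β` and `β_{k+2}(ε, v) → L` as `ε → 0⁺`, then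
`|L − β_{k+1}(v)| ≤ c·θ^k` (closedness of the bound under limits).  So, for β-functions continuous at zero bare coupling in their first variable
and forgetting it at rate `ω`, NE4 IS the statement at zero bare coupling, modulo constants and the rate `max θ ω`. [folklore] -/
theorem rightLimit_bound_of_scaleShiftRate {β : HBeta} {γ c θ : ℝ} (hγ : 0 < γ) (hS : ScaleShiftRate c θ γ β)
    {k : ℕ} {v : Fin (k + 1) → ℝ} (hv : v ∈ Box γ k) {L : ℝ}
    (hL : Tendsto (fun ε : ℝ => β (k + 1) (Fin.cons ε v)) (𝓝[>] 0) (𝓝 L)) :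
    |L - β k v| ≤ c * θ ^ k := by
  -- the bound holds along `]0, γ]`, a set which accumulates at `0⁺`
  have hev : ∀ᶠ ε in 𝓝[>] (0 : ℝ), |β (k + 1) (Fin.cons ε v) - β k v| ≤ c * θ ^ k := by
    have hmem : Set.Ioo (0 : ℝ) γ ∈ 𝓝[>] (0 : ℝ) := Ioo_mem_nhdsGT hγ
    filter_upwards [hmem] with ε hε
    have hw : (Fin.cons ε v : Fin (k + 2) → ℝ) ∈ Box γ (k + 1) := by
      refine mem_box.mpr fun i => Fin.cases ?_ (fun j => ?_) i
      · simpa using And.intro hε.1 hε.2.le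
      · simpa using (mem_box.mp hv) j
    have h := hS k (Fin.cons ε v) hw
    rwa [Fin.tail_cons] at h
  have hlim2 : Tendsto (fun ε : ℝ => |β (k + 1) (Fin.cons ε v) - β k v|) (𝓝[>] 0) (𝓝 |L - β k v|) :=
    (hL.sub_const (β k v)).abs
  exact le_of_tendsto hlim2 hev

end Summit.QuantumFields.BalabanUV.T4Continuum.Spine.NE4.ScaleShiftFreeStep

end
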